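import Summits.BirchSwinnertonDyer.BirchSwinnertonDyer.Theorems.KimAtThreeDeepLowerOffStratumLevelLoweringVatsalStab
import Literature.NumberTheory.EllipticCurves.NewformsCoeffFieldHolds
import Literature.NumberTheory.EllipticCurves.LFunctionPrimeCoeff
import Literature.NumberTheory.EllipticCurves.PAdicBSDSplitMultiplicativeProofs
import Literature.NumberTheory.EllipticCurves.RootNumberAtkinLehnerSemistableProofs
import Mathlib.Analysis.Normed.Unbundled.SpectralNorm
import HarnessLib

/-!
# Route `KimAtThreeKolyvagin` (rung W2), crux `DeepLowerAtThreeOffKatoStratum` (item 19679), registered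
# stub `stub_nonAdditive`, ROAD (b): the 19679 rows with `v₃(∏ c_ℓ) ≤ 1` FROM A LEVEL-`N/q` NEWFORM
# CONGRUENT TO `D₀.f` (Ribet's form) — Vatsal / Greenberg–Vatsal by name + THEOREM B

Cell `bsd-addord`, seat `bsd-addord-w2-acc2` (PROGRAMME PART 1b, ACCEL-LIST row (2)), gen 4; item
`stmt-BirchSwinnertonDyer-19679` (OWNER w2-c2 assembles; `--supports`, closes nothing). Fourth file of ROAD
(b): `…LevelLoweringVatsal` (THEOREM A core) → `…VatsalRows` (rows from the named facts, `g'` displayed) →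
`…VatsalStab` (THEOREM B: `g' = ι₁ g − β ι_q g` in `CuspForm` currency) → THIS FILE, which discharges every
hypothesis of the displayed `g'` from a NEWFORM `g ∈ S₂(Γ₀(M))`, `M·q = N_E`, `q ∤ M` a prime of SPLIT
multiplicative reduction:

* §1 `norm_le_one_of_isIntegral_int` (an algebraic integer in `ℚ̄₃` has norm `≤ 1`: spectral norm),
  `valuation_cuspCoeff_le_one_of_isNewform0` (the DISCHARGED fact `IsNewform0.isIntegral_coeff_holds`),
  `norm_root_le_one` (a root of `X² − aX + q`, `a` integral, is integral).
* §2 `valuation_cuspCoeff_stab_le_one` (the coefficients of `g'` are `3`-integral),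
  `finiteDimensional_coeffField_stab` (`K_{g'} ⊆ K_g(β)` is a number field: the DISCHARGED fact
  `IsNewform0.finiteDimensional_coeffField_holds` + `β` integral over `K_g`).
* §3 `valuation_div_sub_one_lt_one` (`a_q(g) ≡ q + 1`, `β ≡ q` ⟹ `α = a_q(g) − β ≡ 1` and `c = β/q = α⁻¹ ≡ 1`;
  uniform in `q`, including `q = 3`), `lFunction_eq_one_of_hasSplitMultiplicativeReductionAtPrime` (`a_q(E) = 1`).
* §4 ★ `isStabilisedLevelLoweringCongruenceIn_three_of_levelLoweredNewform`: (LL_1) over `𝓀` on a non-additive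
  tower row from the two named facts + the level-`M` newform data;
  ★ `stub_nonAdditive_semistable_of_vatsal_of_levelLoweredNewform`: the registered stub on its SEMISTABLE rows
  with `v₃(∏ c_ℓ) ≤ 1` (gen 2's Rekey consumer).

RESIDUAL of `stub_nonAdditive` on the semistable depth-`1` Tamagawa rows after this file, BY NAME and TYPED:
(R1) EXISTENCE of the newform `g` of level `M = N_E/q` with `a_ℓ(g) ≡ a_ℓ(E) (mod 𝔪)` for every prime `ℓ ≠ q`
and `a_q(g) ≡ q + 1` — Ribet 1990 Thm. 1.1 / Diamond 1995 (tree fact `diamond1995_refinedSerre`, which is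
typed over `Γ₁(M')`, `M' ∣ N(ρ̄)`, Serre weight, congruences at the primes `∤ 3M'` only: the passage to
`Γ₀(N_E/q)` with congruences ALSO at the other bad primes and at `q` is Carayol's lemma + local–global
compatibility at `ℓ ∣ M`, not in the tree — hence displayed); (R2) Vatsal's Condition 1 for `D₀.f` (newform;
strong multiplicity one in `S₂(Γ₀(N))`) and for `g'` (= `U_q` semisimple on the `q`-old plane, `α ≠ β`:
automatic when `q ≢ 1 (mod 3)`, Coleman–Edixhoven 1998 in weight `2` otherwise); (R3) Ihara's lemma read
on plus symbols (non-vanishing mod `𝔭` of the stabilised optimally-integral symbol of `g`; tree fact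
`ribet1984_iharaLemma` in period-homology currency + the Manin–Drinfeld/eigencharacter datum for `g`, cell
b2b-bsdres' `hasOldEigenPlusSymb_of_ribet1984_iharaLemma` being the model) — plus named print. Theorems only;
nothing booked; BSD is not proved by any of this.

## References

* V. Vatsal, Duke Math. J. 98 (1999), §1 (1.6), Remark (1.12), Thm. (1.13). [Vatsal1999]
* R. Greenberg, V. Vatsal, Invent. Math. 142 (2000), §3 (17)–(19), Lemma (3.6). [GreenbergVatsal2000]
* K. A. Ribet, Invent. Math. 100 (1990), Thm. 1.1 [Ribet1990]; Proc. ICM 1983 (1984), Thm. 4.1 [Ribet1984ICM].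
* G. Shimura, *Introduction to the arithmetic theory of automorphic functions* (1971), Thm. 3.48. [Shimura1971]
* F. Diamond, J. Shurman (2005), §5.7, Prop. 5.8.5 [DiamondShurman2005]; J. H. Silverman, *AEC* (2009), §C.16
  [SilvermanAEC2009]; C. Skinner, Pacific J. Math. 283 (2016), Thm. C [Skinner2016PacificMC]; B. Mazur, Invent.
  Math. 44 (1978), Cor. 4.1 [Mazur1978]; C.-H. Kim (2022/2026), Conj. 1.10 [Kim2022StructureSelmer].
-/

set_option autoImplicit false
-- the Theorems namespace of a single-conjunct summit repeats the summit name by design (D-0017)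
set_option linter.dupNamespace false

noncomputable section

open scoped MatrixGroups ModularForm Classical NNReal IntermediateField

open CongruenceSubgroup WeierstrassCurve Literature.NumberTheory.EllipticCurves
  Literature.NumberTheory.EllipticCurves.ModularForms Polynomial
open UpperHalfPlane hiding I

namespace Summit.BirchSwinnertonDyer.BirchSwinnertonDyer.Theorems.KimAtThreeDeepLowerOffStratumLevelLoweringVatsalStabRows

open Summit.BirchSwinnertonDyer.BirchSwinnertonDyer.Theorems.KimAtThreeDeepLowerOffStratumLevelLoweringVatsal
open Summit.BirchSwinnertonDyer.BirchSwinnertonDyer.Theorems.KimAtThreeDeepLowerOffStratumLevelLoweringVatsalRows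
open Summit.BirchSwinnertonDyer.BirchSwinnertonDyer.Theorems.KimAtThreeDeepLowerOffStratumLevelLoweringVatsalStab

/-! ### §1 Integrality in `ℚ̄₃`: algebraic integers, the coefficients of a newform, the root `β` -/

section Integral

/-- An element of `ℚ̄₃` integral over `ℤ` has norm `≤ 1` (spectral norm of a root of a monic polynomial with
integral coefficients; Bosch–Güntzer–Remmert 3.1.2/1). [folklore] -/
theorem norm_le_one_of_isIntegral_int {x : PadicAlgCl 3} (hx : IsIntegral ℤ x) : ‖x‖ ≤ 1 := by
  obtain ⟨f, hf, hfx⟩ := hx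
  set g : ℚ_[3][X] := f.map (algebraMap ℤ ℚ_[3]) with hg
  have hgm : g.Monic := hf.map _
  have hgx : aeval x g = 0 := by
    rw [hg, aeval_map_algebraMap]
    exact hfx
  have hcoef : ∀ n : ℕ, ‖g.coeff n‖ ≤ 1 := fun n => by
    rw [hg, coeff_map, eq_intCast]
    exact Padic.norm_int_le_one _
  have h1 : spectralValue g ≤ 1 := (spectralValue_le_one_iff hgm).mpr hcoef
  have h2 : spectralAlgNorm ℚ_[3] (PadicAlgCl 3) x ≤ spectralValue g :=
    norm_root_le_spectralValue spectralAlgNorm_isPowMul isNonarchimedean_spectralNorm hgm hgx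
  rw [← PadicAlgCl.spectralNorm_eq]
  exact h2.trans h1

/-- The Fourier coefficients of a newform are `3`-adically integral (they are algebraic integers:
`IsNewform0.isIntegral_coeff_holds`, Shimura Thm. 3.48). [cite: Shimura1971, Thm. 3.48] -/
theorem valuation_cuspCoeff_le_one_of_isNewform0 {M : ℕ} [NeZero M] {g : CuspForm (Gamma0 M) 2}
    (hg : IsNewform0 g) (ι : PadicAlgCl 3 ≃+* ℂ) (n : ℕ) : Valued.v (ι.symm (cuspCoeff g n)) ≤ 1 := by
  refine valuation_le_one_iff.mpr (norm_le_one_of_isIntegral_int ?_)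
  have h := IsNewform0.isIntegral_coeff_holds hg n
  exact h.map (ι.symm : ℂ →+* PadicAlgCl 3).toIntAlgHom

/-- A root `β` of `X² − aX + q` with `a` integral is integral: `‖β‖ ≤ 1` (else `‖β²‖ > ‖aβ − q‖`). [folklore] -/
theorem norm_root_le_one {a b : PadicAlgCl 3} {q : ℕ} (ha : ‖a‖ ≤ 1) (hb : b ^ 2 - a * b + q = 0) : ‖b‖ ≤ 1 := by
  by_contra h
  push Not at h
  have hb' : b ^ 2 = a * b - q := by linear_combination hb
  have h1 : ‖b ^ 2‖ = ‖b‖ * ‖b‖ := by rw [norm_pow, pow_two]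
  have h2 : ‖a * b - q‖ ≤ max (‖a * b‖) ‖(q : PadicAlgCl 3)‖ := by
    rw [sub_eq_add_neg]
    refine (PadicAlgCl.isNonarchimedean 3 _ _).trans ?_
    rw [norm_neg]
  have h3 : ‖a * b‖ ≤ ‖b‖ := by rw [norm_mul]; exact mul_le_of_le_one_left (norm_nonneg _) ha
  have h4 : ‖(q : PadicAlgCl 3)‖ ≤ 1 := by
    have := norm_intCast_le_one (q : ℤ)
    rwa [Int.cast_natCast] at this
  have h5 : ‖b‖ * ‖b‖ ≤ ‖b‖ := by
    rw [← h1, hb']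
    exact h2.trans (max_le h3 (h4.trans h.le))
  have hb0 : 0 < ‖b‖ := lt_trans zero_lt_one h
  have h6 : ‖b‖ ≤ 1 := le_of_mul_le_mul_right (by rwa [one_mul]) hb0
  exact (not_le.mpr h) h6

end Integral

/-! ### §2 The data of THEOREM A for `g' = ι₁ g − β ι_q g` -/

section Data

variable {M q : ℕ} [NeZero M] [NeZero q] {g : CuspForm (Gamma0 M) 2} (hg : IsNewform0 g)
  (ι : PadicAlgCl 3 ≃+* ℂ) (β : ℂ) (h1 : M * 1 ∣ M * q) (hMq : M * q ∣ M * q)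
include hg

/-- The coefficients of the stabilised form are `3`-integral. [cite: Shimura1971, Thm. 3.48] -/
theorem valuation_cuspCoeff_stab_le_one (hβ : β ^ 2 - cuspCoeff g q * β + q = 0) (n : ℕ) :
    Valued.v (ι.symm (cuspCoeff (iota M (M * q) 1 2 h1 g - β • iota M (M * q) q 2 hMq g) n)) ≤ 1 := by
  have hβ' : ‖ι.symm β‖ ≤ 1 := by
    refine norm_root_le_one (a := ι.symm (cuspCoeff g q)) (q := q)
      (valuation_le_one_iff.mp (valuation_cuspCoeff_le_one_of_isNewform0 hg ι q)) ?_
    have h := congrArg ι.symm hβ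
    rwa [map_add, map_sub, map_pow, map_mul, map_natCast, map_zero] at h
  have hco := cuspCoeff_stab g β h1 hMq n
  rw [hco, map_sub, map_mul, sub_eq_add_neg]
  refine valuation_le_one_iff.mpr ((PadicAlgCl.isNonarchimedean 3 _ _).trans (max_le ?_ ?_))
  · exact valuation_le_one_iff.mp (valuation_cuspCoeff_le_one_of_isNewform0 hg ι n)
  · rw [norm_neg, norm_mul]
    refine mul_le_one₀ hβ' (norm_nonneg _) ?_
    by_cases hqn : q ∣ n
    · rw [if_pos hqn]
      exact valuation_le_one_iff.mp (valuation_cuspCoeff_le_one_of_isNewform0 hg ι _)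
    · rw [if_neg hqn, map_zero, norm_zero]
      exact zero_le_one

/-- **The coefficient field of the stabilised form is a number field**: it lies in `K_g(β)`, `K_g` a number
field (`IsNewform0.finiteDimensional_coeffField_holds`) and `β` a root of `X² − a_q(g)X + q ∈ K_g[X]`.
[cite: Shimura1971, Thm. 3.48] -/
theorem finiteDimensional_coeffField_stab (hβ : β ^ 2 - cuspCoeff g q * β + q = 0) :
    FiniteDimensional ℚ (coeffField (iota M (M * q) 1 2 h1 g - β • iota M (M * q) q 2 hMq g)) := by
  set K : IntermediateField ℚ ℂ := coeffField g with hK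
  haveI : FiniteDimensional ℚ K := IsNewform0.finiteDimensional_coeffField_holds hg
  set a : K := ⟨cuspCoeff g q, coeff_mem_coeffField g q⟩ with ha
  -- `β` is integral over `K`
  have hβint : IsIntegral K β := by
    refine ⟨X ^ 2 + (-(C a * X) + C (q : K)), ?_, ?_⟩
    · refine monic_X_pow_add ?_
      refine lt_of_le_of_lt (degree_add_le _ _) (max_lt ?_ ?_)
      · rw [degree_neg]
        exact lt_of_le_of_lt (degree_C_mul_X_le a) (by decide)
      · exact lt_of_le_of_lt degree_C_le (by decide)
    · have : eval₂ (algebraMap K ℂ) β (X ^ 2 + (-(C a * X) + C (q : K))) = β ^ 2 - cuspCoeff g q * β + q := by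
        simp [ha]
        ring
      rw [this, hβ]
  haveI : FiniteDimensional K K⟮β⟯ := IntermediateField.adjoin.finiteDimensional hβint
  haveI hL : FiniteDimensional ℚ K⟮β⟯ := Module.Finite.trans K K⟮β⟯
  set L' : IntermediateField ℚ ℂ := IntermediateField.restrictScalars ℚ K⟮β⟯ with hL'
  haveI : FiniteDimensional ℚ L' := hL
  have hle : coeffField (iota M (M * q) 1 2 h1 g - β • iota M (M * q) q 2 hMq g) ≤ L' := by
    rw [coeffField, IntermediateField.adjoin_le_iff]
    rintro _ ⟨n, rfl⟩
    show (qExpansion 1 ⇑(iota M (M * q) 1 2 h1 g - β • iota M (M * q) q 2 hMq g)).coeff n ∈ K⟮β⟯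
    have hco := cuspCoeff_stab g β h1 hMq n
    rw [cuspCoeff] at hco
    rw [hco]
    have hmemK : ∀ m : ℕ, cuspCoeff g m ∈ K⟮β⟯ := fun m =>
      IntermediateField.algebraMap_mem K⟮β⟯ (⟨cuspCoeff g m, coeff_mem_coeffField g m⟩ : K)
    refine sub_mem (hmemK n) (mul_mem (IntermediateField.mem_adjoin_simple_self K β) ?_)
    split_ifs
    · exact hmemK _
    · exact zero_mem _
  exact FiniteDimensional.of_injective (IntermediateField.inclusion hle).toLinearMap
    (IntermediateField.inclusion_injective hle)

end Data

/-! ### §3 The remaining road-(b) data: `c = β/q ≡ 1`, the prime congruences, `a_q(E) = 1` at a split prime -/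

section Bridge

/-- **`c = β/q ≡ 1` and `α = a − β ≡ 1`** when `a ≡ q + 1`, `β ≡ q` and `β² − aβ + q = 0` (so `αβ = q`,
`c = α⁻¹`): `v(c − 1) = v(1 − α) < 1`. [folklore] -/
theorem valuation_div_sub_one_lt_one (ι : PadicAlgCl 3 ≃+* ℂ) {a β : ℂ} {q : ℕ} (hq : q.Prime)
    (hβ : β ^ 2 - a * β + q = 0) (ha : Valued.v (ι.symm (a - (q + 1))) < 1)
    (hβq : Valued.v (ι.symm (β - q)) < 1) :
    Valued.v (ι.symm (a - β - 1)) < 1 ∧ Valued.v (ι.symm (β / q - 1)) < 1 := by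
  have hα1 : Valued.v (ι.symm (a - β - 1)) < 1 := by
    have : ι.symm (a - β - 1) = ι.symm (a - (q + 1)) - ι.symm (β - q) := by
      rw [← map_sub]; congr 1; ring
    rw [this]
    exact lt_of_le_of_lt (Valuation.map_sub _ _ _) (max_lt ha hβq)
  refine ⟨hα1, ?_⟩
  set α : PadicAlgCl 3 := ι.symm (a - β) with hαdef
  have hα1' : ‖α - 1‖ < 1 := by
    rw [hαdef, ← map_one ι.symm, ← map_sub]
    exact valuation_lt_one_iff.mp hα1
  have hαnorm : ‖α‖ = 1 := by
    have h := IsUltrametricDist.norm_add_eq_max_of_norm_ne_norm (x := α - 1) (y := (1 : PadicAlgCl 3))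
      (by rw [norm_one]; exact hα1'.ne)
    rw [sub_add_cancel, norm_one, max_eq_right hα1'.le] at h
    exact h
  have hα0 : α ≠ 0 := fun h => by rw [h, norm_zero] at hαnorm; exact zero_ne_one hαnorm
  have hq0 : (q : PadicAlgCl 3) ≠ 0 := by exact_mod_cast hq.ne_zero
  have hprod : α * ι.symm β = q := by
    have h := congrArg ι.symm hβ
    rw [map_add, map_sub, map_pow, map_mul, map_natCast, map_zero] at h
    rw [hαdef, map_sub]
    linear_combination -h
  have hβ0 : ι.symm β ≠ 0 := fun h => hq0 (by rw [← hprod, h, mul_zero])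
  have key : ι.symm (β / q - 1) = (1 - α) / α := by
    rw [map_sub, map_one, map_div₀, map_natCast, ← hprod]
    field_simp
  refine valuation_lt_one_iff.mpr ?_
  rw [key, norm_div, hαnorm, div_one, ← norm_neg, neg_sub]
  exact hα1'

/-- `a_q(E) = 1` at a prime of SPLIT multiplicative reduction (Silverman *AEC* §C.16, local factor `1 − T`; tree
`LFunction_apply_primesEquiv_of_hasSplitMultiplicativeReductionAt` at the place over `q`).
[cite: SilvermanAEC2009, §C.16 (definition of L_v(T))] -/
theorem lFunction_eq_one_of_hasSplitMultiplicativeReductionAtPrime (W : WeierstrassCurve ℚ) [W.IsElliptic]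
    (q : ℕ) [hq : Fact q.Prime] (h : W.HasSplitMultiplicativeReductionAtPrime q) : W.LFunction q = 1 := by
  obtain ⟨v, hv⟩ : ∃ v : IsDedekindDomain.HeightOneSpectrum (NumberField.RingOfIntegers ℚ),
      ((Rat.HeightOneSpectrum.primesEquiv v : ℕ)) = q :=
    ⟨Rat.HeightOneSpectrum.primesEquiv.symm ⟨q, hq.out⟩, by rw [Equiv.apply_symm_apply]⟩
  subst hv
  exact W.LFunction_apply_primesEquiv_of_hasSplitMultiplicativeReductionAt
    ((W.hasSplitMultiplicativeReductionAtPrime_iff_hasSplitMultiplicativeReductionAt v).mp h)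

end Bridge

/-! ### §4 ★ The 19679 rows from a LEVEL-`N/q` NEWFORM congruent to `D₀.f` (Ribet's form, displayed) -/

section Rows

open Summit.BirchSwinnertonDyer.BirchSwinnertonDyer.Theorems.KimAtThreeDeepLowerOffStratumLevelLoweringRekey
open Literature.NumberTheory.EllipticCurves.Rank1Residual Literature.NumberTheory.EllipticCurves.Rank1Residual.Typed
  Literature.NumberTheory.EllipticCurves.Skinner2016 Literature.NumberTheory.Automorphic

/-- **All of THEOREM A's road-(b) data from a level-`M` newform `g` congruent to the newform `f` of `W` at level
`Mq`** (`q ∤ M` prime of split multiplicative reduction, `W[3]`-tower row): with `g' = ι₁ g − β ι_q g`,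
`Φ = plusSymbol g`, `c = β/q`, `b_ℓ = a_ℓ(g)` — eigenform, normalised, number-field and `3`-integral
coefficients, `aₙ(f) ≡ aₙ(g')` for ALL `n`, old shape, `c ≡ 1`, periodicity and Hecke relations of `Φ` with
eigenvalues `≡ a_ℓ(E)`; hence (LL_1) over `𝓀` by `isStabilisedLevelLoweringCongruenceIn_three_of_not_addv`,
GIVEN the two named facts, Condition 1 for `f` and `g'`, and the non-degeneracy `Ω`.
[cite: Vatsal1999, §1 (1.6), Thm. (1.13)] [cite: GreenbergVatsal2000, §3 (17)–(19), Lemma (3.6)]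
[cite: DiamondShurman2005, §5.7 and Prop. 5.8.5] -/
theorem isStabilisedLevelLoweringCongruenceIn_three_of_levelLoweredNewform
    (hV : vatsal1999_plusSymbol_congruence) (hGV : greenbergVatsal2000_plusSymbol_congruence)
    (W₀ : WeierstrassCurve ℚ) [W₀.IsElliptic] [W₀.IsGloballyMinimal]
    (htower : ∀ n : ℕ, W₀.HasSurjectiveModNGaloisRep (3 ^ n : ℕ)) {M q : ℕ} [NeZero M] [NeZero q] (hq : q.Prime)
    [NeZero (M * q)] (hN : M * q = W₀.conductorNorm ℤ) (D₀ : ModularParametrizationData W₀ (M * q))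
    (hint : ∀ r : ℚ, ratPlusSymbol D₀.f r ≠ 0 → 0 ≤ padicValRat 3 (ratPlusSymbol D₀.f r))
    (hnA : ¬ (haveI : Fact (Nat.Prime 3) := ⟨Nat.prime_three⟩; Addv W₀ 3))
    (hsplit : (haveI : Fact q.Prime := ⟨hq⟩; W₀.HasSplitMultiplicativeReductionAtPrime q))
    (ι : PadicAlgCl 3 ≃+* ℂ) {g : CuspForm (Gamma0 M) 2} (hg : IsNewform0 g) (hqM : ¬ q ∣ M)
    (hcℓ : ∀ ℓ : ℕ, ℓ.Prime → ℓ ≠ q → Valued.v (ι.symm (cuspCoeff D₀.f ℓ - cuspCoeff g ℓ)) < 1)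
    (haq : Valued.v (ι.symm (cuspCoeff g q - (q + 1))) < 1)
    {β : ℂ} (hβ : β ^ 2 - cuspCoeff g q * β + q = 0) (hβq : Valued.v (ι.symm (β - q)) < 1)
    (hfC : HasSimpleHeckeGenEigenspace D₀.f)
    (hgC : HasSimpleHeckeGenEigenspace
      (iota M (M * q) 1 2 (mul_dvd_mul_left M (one_dvd q)) g - β • iota M (M * q) q 2 dvd_rfl g))
    {Ω : ℂ} (hΩint : ∀ x : ℚ, Valued.v (ι.symm (plusSymbol g x / Ω)) ≤ 1)
    (hΩunit : ∃ x₀ : ℚ, Valued.v (ι.symm ((plusSymbol g x₀ - β / q * plusSymbol g (q * x₀)) / Ω)) = 1) :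
    ∃ π : ZMod 3 →+* IsLocalRing.ResidueField (Valued.integer (PadicAlgCl 3)),
      IsStabilisedLevelLoweringCongruenceIn W₀ 3 1 D₀.f q π := by
  haveI : Fact q.Prime := ⟨hq⟩
  set h1 : M * 1 ∣ M * q := mul_dvd_mul_left M (one_dvd q) with hh1
  set g' := iota M (M * q) 1 2 h1 g - β • iota M (M * q) q 2 dvd_rfl g with hg'def
  have hf := D₀.isNewformOf
  obtain ⟨hα1, hc⟩ := valuation_div_sub_one_lt_one ι hq hβ haq hβq
  -- `a_q(f) = 1`
  have hfq : cuspCoeff D₀.f q = 1 := by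
    rw [hf.2 q, lFunction_eq_one_of_hasSplitMultiplicativeReductionAtPrime W₀ q hsplit, Int.cast_one]
  -- congruence for ALL `n`
  have hcong : ∀ n : ℕ, Valued.v (ι.symm (cuspCoeff D₀.f n - cuspCoeff g' n)) < 1 := by
    refine valuation_cuspCoeff_sub_lt_one_of_prime ι hf.1.2.1 (isHeckeEigenform_stab hg β h1 dvd_rfl hq hqM hβ)
      hf.1.2.2 (isNormalized_stab g β h1 dvd_rfl hg.2.2 hq) (valuation_cuspCoeff_le_one_of_isNewformOf W₀ hf ι)
      (valuation_cuspCoeff_stab_le_one hg ι β h1 dvd_rfl hβ) fun ℓ hℓ => ?_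
    rw [cuspCoeff_stab_prime hg β h1 dvd_rfl hq hℓ]
    by_cases hℓq : ℓ = q
    · subst hℓq
      rw [if_pos rfl, hfq]
      have : ι.symm (1 - (cuspCoeff g ℓ - β)) = -ι.symm (cuspCoeff g ℓ - β - 1) := by
        rw [← map_neg]; congr 1; ring
      rw [this, Valuation.map_neg]
      exact hα1
    · rw [if_neg hℓq]
      exact hcℓ ℓ hℓ hℓq
  -- Hecke relations of `Φ = plusSymbol g` at the primes `ℓ ∤ 3N_E` (`ℓ ∤ M`), eigenvalues `a_ℓ(g) ≡ a_ℓ(E)`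
  have hb : ∀ ℓ : ℕ, ℓ.Prime → ¬ ℓ ∣ W₀.conductorNorm ℤ * 3 →
      Valued.v (ι.symm (cuspCoeff g ℓ - (W₀.frobeniusTrace ℓ : ℂ))) < 1 := by
    intro ℓ hℓ hℓN3
    haveI : Fact ℓ.Prime := ⟨hℓ⟩
    have hℓN : ¬ ℓ ∣ W₀.conductorNorm ℤ := fun h => hℓN3 (h.mul_right 3)
    have hℓq : ℓ ≠ q := by rintro rfl; exact hℓN (hN ▸ dvd_mul_left ℓ M)
    have hfℓ : cuspCoeff D₀.f ℓ = (W₀.frobeniusTrace ℓ : ℂ) := by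
      rw [hf.2 ℓ, LFunction_apply_prime_eq_frobeniusTrace W₀ ℓ
        (hasGoodReductionAtPrime_of_not_dvd_conductorNorm W₀ hℓN)]
    rw [← hfℓ, ← Valuation.map_neg, ← map_neg, neg_sub]
    exact hcℓ ℓ hℓ hℓq
  have hΦhecke : ∀ ℓ : ℕ, ℓ.Prime → ¬ ℓ ∣ W₀.conductorNorm ℤ * 3 → ∀ x : ℚ,
      cuspCoeff g ℓ * plusSymbol g x = (∑ j : Fin ℓ, plusSymbol g ((x + j) / ℓ)) + plusSymbol g (ℓ * x) := by
    intro ℓ hℓ hℓN3 x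
    haveI : NeZero ℓ := ⟨hℓ.ne_zero⟩
    have hℓM : ¬ ℓ ∣ M := fun h => hℓN3 ((hN ▸ h.mul_right q).mul_right 3)
    exact cuspCoeff_mul_plusSymbol ℓ hg hℓ hℓM x
  have hΦper : ∀ x : ℚ, plusSymbol g (x + 1) = plusSymbol g x := by
    intro x
    have h₁ := modularSymbol_add_intCast_holds g x 1
    have h₂ := modularSymbol_add_intCast_holds g (-x) (-1)
    simp only [plusSymbol]
    rw [show -(x + 1) = -x + ((-1 : ℤ) : ℚ) by push_cast; ring, h₂, show x + 1 = x + ((1 : ℤ) : ℚ) by push_cast; ring,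
      h₁]
  exact isStabilisedLevelLoweringCongruenceIn_three_of_not_addv hV hGV W₀ htower (N := M * q) hN D₀ hint hnA ι g'
    q hfC (isHeckeEigenform_stab hg β h1 dvd_rfl hq hqM hβ) (isNormalized_stab g β h1 dvd_rfl hg.2.2 hq)
    (finiteDimensional_coeffField_stab hg β h1 dvd_rfl hβ) (valuation_cuspCoeff_stab_le_one hg ι β h1 dvd_rfl hβ) hgC
    hcong (plusSymbol g) (β / q) (fun ℓ => cuspCoeff g ℓ) (plusSymbol_stab g β h1 dvd_rfl) hc hΦper hb hΦhecke hΩint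
    hΩunit


/-- ★ **`stub_nonAdditive` on its SEMISTABLE rows with `v₃(∏ c_ℓ) ≤ 1`, from VATSAL / GREENBERG–VATSAL BY NAME and a
LEVEL-`N/q` NEWFORM congruent to `D₀.f`** (Ribet's form, DISPLAYED in `CuspForm` currency). Binders: the eight
named facts (`hV hGV hSk hmod hGZK hM hBCDT hLL'`); the registered stub's binders VERBATIM with the level written
`M·q`; `Semistable W₀`, «ordinary if good», `v₃(∏ c_ℓ) ≤ 1`; `q` SPLIT multiplicative (the Tamagawa-`3` prime);
then the road-(b) residual: a newform `g ∈ S₂(Γ₀(M))` (`q ∤ M`) with `a_ℓ(D₀.f) ≡ a_ℓ(g)` at every prime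
`ℓ ≠ q` and `a_q(g) ≡ q + 1` (IN PRINT: Ribet 1990 Thm. 1.1 = `diamond1995_refinedSerre`, `ρ̄_{E,3}` being
unramified at `q` as `3 ∣ c_q`), a root `β ≡ q` of `X² − a_q(g)X + q`, Vatsal's Condition 1 for `D₀.f` and for
`ι₁ g − β ι_q g` (IN PRINT: newform, resp. `α ≠ β`), and the NON-DEGENERACY `Ω` of `plusSymbol g` (IN PRINT:
Ihara's lemma, Ribet 1984 Thm. 4.1 = `ribet1984_iharaLemma`). [cite: Vatsal1999, §1 (1.6), Thm. (1.13)]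
[cite: GreenbergVatsal2000, §3 (17)–(19)] [cite: Ribet1990, Thm. 1.1] [cite: Ribet1984ICM, Thm. 4.1]
[cite: Skinner2016PacificMC, Thm. C (§1)] [cite: Mazur1978, Cor. 4.1]
[cite: Kim2022StructureSelmer, Conj. 1.10 (PDF p. 8)] -/
theorem stub_nonAdditive_semistable_of_vatsal_of_levelLoweredNewform
    (hV : vatsal1999_plusSymbol_congruence) (hGV : greenbergVatsal2000_plusSymbol_congruence)
    (hSk : Skinner2016.thmC_padicValRat_bsd_rank_zero)
    (hmod : hasEntireLFunction_rat) (hGZK : rank_eq_analyticRank_of_analyticRank_le_one)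
    (hM : mazur_not_dvd_maninConstant_of_odd)
    (hBCDT : exists_isNewformOf) (hLL' : diamond1995_refinedSerre) :
    ∀ (W₀ : WeierstrassCurve ℚ) [W₀.IsElliptic] [W₀.IsGloballyMinimal],
      (∀ n : ℕ, W₀.HasSurjectiveModNGaloisRep (3 ^ n : ℕ)) → Finite W₀.sha →
      ∀ {M q : ℕ} [NeZero M] [NeZero q] [Fact q.Prime] [NeZero (M * q)], M * q = W₀.conductorNorm ℤ →
      ∀ (D₀ : ModularParametrizationData W₀ (M * q)),
        (∀ z ∈ D₀.L.lattice, ∃ w ∈ periodLattice D₀.f, z = D₀.c * w) →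
        (∀ (W₂ : WeierstrassCurve ℚ) [W₂.IsElliptic] (D₂ : ModularParametrizationData W₂ (M * q)),
          D₂.f = D₀.f → D₀.modularDegree ≤ D₂.modularDegree) →
        (∀ r : ℚ, ratPlusSymbol D₀.f r ≠ 0 → 0 ≤ padicValRat 3 (ratPlusSymbol D₀.f r)) →
        kuriharaVanishingOrder W₀ 3 D₀.f = 0 →
        ¬ (haveI : Fact (Nat.Prime 3) := ⟨Nat.prime_three⟩; Addv W₀ 3) →
        Semistable W₀ →
        (W₀.HasGoodReductionAtPrime 3 → ¬ (3 : ℤ) ∣ W₀.frobeniusTrace 3) →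
        padicValNat 3 W₀.tamagawaProduct ≤ 1 →
        W₀.HasSplitMultiplicativeReductionAtPrime q →
        ∀ (ι : PadicAlgCl 3 ≃+* ℂ) (g : CuspForm (Gamma0 M) 2), IsNewform0 g → ¬ q ∣ M →
          (∀ ℓ : ℕ, ℓ.Prime → ℓ ≠ q → Valued.v (ι.symm (cuspCoeff D₀.f ℓ - cuspCoeff g ℓ)) < 1) →
          Valued.v (ι.symm (cuspCoeff g q - (q + 1))) < 1 →
        ∀ (β : ℂ), β ^ 2 - cuspCoeff g q * β + q = 0 → Valued.v (ι.symm (β - q)) < 1 →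
          HasSimpleHeckeGenEigenspace D₀.f →
          HasSimpleHeckeGenEigenspace
            (iota M (M * q) 1 2 (mul_dvd_mul_left M (one_dvd q)) g - β • iota M (M * q) q 2 dvd_rfl g) →
        ∀ (Ω : ℂ), (∀ x : ℚ, Valued.v (ι.symm (plusSymbol g x / Ω)) ≤ 1) →
          (∃ x₀ : ℚ, Valued.v (ι.symm ((plusSymbol g x₀ - β / q * plusSymbol g (q * x₀)) / Ω)) = 1) →
        ∃ d : ℕ, kuriharaPartialDeepInfty W₀ 3 D₀.f = d ∧
          kuriharaPartial W₀ 3 D₀.f 0 ≤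
            ((padicValNat 3 (Nat.card (AddCommGroup.primaryComponent W₀.sha 3)) + d : ℕ) : ℕ∞) := by
  intro W₀ _ _ htower hfin M q _ _ _ _ hN D₀ hopt hdeg hint hord hnA hsst hordinary hv hsplit ι g hg hqM hcℓ haq β hβ
    hβq hfC hgC Ω hΩint hΩunit
  obtain ⟨π, hLL⟩ := isStabilisedLevelLoweringCongruenceIn_three_of_levelLoweredNewform hV hGV W₀ htower Fact.out hN D₀
    hint hnA hsplit ι hg hqM hcℓ haq hβ hβq hfC hgC hΩint hΩunit
  exact stub_nonAdditive_semistable_of_isStabilisedLevelLoweringCongruenceIn hSk hmod hGZK hM hBCDT hLL' W₀ htower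
    hfin hN D₀ hopt hdeg hint hord hnA hsst hordinary hv π q (hN ▸ dvd_mul_left q M) hLL

end Rows

end Summit.BirchSwinnertonDyer.BirchSwinnertonDyer.Theorems.KimAtThreeDeepLowerOffStratumLevelLoweringVatsalStabRows

end
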